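import Mathlib
import Summits.CriticalPhenomena.SAWScalingLimit.Theses.SAWDefectDecoherence
import Summits.CriticalPhenomena.SAWScalingLimit.Theorems.SAWDefectDecoherenceObservableToSLERGateTransferPerMesh
import Summits.CriticalPhenomena.SAWScalingLimit.Theorems.SAWDefectDecoherenceObservableToSLERGateTransferProductCells
import Literature.Probability.RandomPlanarGeometry.SLEExistenceNeEightHolds

/-!
# THE GATE TRANSFER (stub `stub_gateTransfer` of the line `bridge-gate-renewal`)

Support file for the stub `stub_gateTransfer` (the gate transfer
`GateDecomposition → RenewalAccumulation → CarvedToSLE → HexTight → FullIdentification`) of the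
line `bridge-gate-renewal` for the crux
`Summit.CriticalPhenomena.SAWScalingLimit.Theses.SAWDefectDecoherence.ObservableToSLER`
(item `stmt-CriticalPhenomena-14005`).

This file proves the registered stub `stub_gateTransfer` itself:
* `ext_of_forall_lipschitz_integral_eq` — bounded Lipschitz functions separate finite Borel
  measures on a metric space (thickened indicators);
* `fullIdentification_of_productCell` — the soft assembly: `GateDecomposition`,
  `RenewalAccumulation`, `CarvedToSLE` and the eventual product structure of the cells identify
  every probability subsequential limit law of the critical hexagonal SAW as the chordal SLE(8/3)
  law (per-mesh estimate, limit along the subsequence, `ε, R → 0`);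
* `stub_gateTransfer` — with `eventually_productCell`.  `HexTight` is not used.
-/

noncomputable section

open scoped BigOperators Topology NNReal ENNReal Classical BoundedContinuousFunction unitInterval
open Filter Set MeasureTheory Metric

namespace Summit.CriticalPhenomena.SAWScalingLimit.Theorems.ObservableToSLER.BridgeGate

open Literature.Probability.LatticeModels (HexVertex hexGraph hexCenter triZeta Site polyline)
open Literature.Probability.RandomPlanarGeometry
open Literature.Probability.RandomPlanarGeometry.SAW
open Summit.CriticalPhenomena.SAWScalingLimit.Theorems.ObservableToSLE.Negative
  (finite_hexDomainSAW eventually_isProbabilityMeasure_hexSAWLaw)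
open Summit.CriticalPhenomena.SAWScalingLimit.Theses.SAWDefectDecoherence (HexTight)

section Final

/-- **Bounded Lipschitz functions separate finite Borel measures on a metric space** (thickened
indicators of closed sets are bounded Lipschitz; closed sets form a generating π-system). -/
theorem ext_of_forall_lipschitz_integral_eq {X : Type*} [MetricSpace X] [MeasurableSpace X]
    [BorelSpace X] {μ ν : Measure X} [IsFiniteMeasure μ] [IsFiniteMeasure ν]
    (h : ∀ (f : X →ᵇ ℝ) (K : ℝ≥0), LipschitzWith K f → ∫ x, f x ∂μ = ∫ x, f x ∂ν) : μ = ν := by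
  have key : ∀ F : Set X, IsClosed F → μ F = ν F := by
    intro F hF
    have hpos : ∀ n : ℕ, (0 : ℝ) < 1 / ((n : ℝ) + 1) := fun n => Nat.one_div_pos_of_nat
    have hμ := tendsto_lintegral_thickenedIndicator_of_isClosed μ hF hpos
      tendsto_one_div_add_atTop_nhds_zero_nat
    have hν := tendsto_lintegral_thickenedIndicator_of_isClosed ν hF hpos
      tendsto_one_div_add_atTop_nhds_zero_nat
    refine tendsto_nhds_unique hμ ?_
    refine hν.congr fun n => ?_
    set g : X →ᵇ ℝ≥0 := thickenedIndicator (hpos n) F with hg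
    let gr : X →ᵇ ℝ := ⟨⟨fun x => (g x : ℝ), NNReal.continuous_coe.comp g.continuous⟩, g.map_bounded'⟩
    have hgr : LipschitzWith (1 / ((n : ℝ) + 1)).toNNReal⁻¹ gr := by
      have hL := lipschitzWith_thickenedIndicator (hpos n) F
      rw [lipschitzWith_iff_dist_le_mul] at hL ⊢
      intro x y
      have := hL x y
      rwa [NNReal.dist_eq, ← Real.dist_eq] at this
    have hint := h gr _ hgr
    have h1 : (∫⁻ x, (g x : ℝ≥0∞) ∂μ).toReal = (∫⁻ x, (g x : ℝ≥0∞) ∂ν).toReal := by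
      rw [BoundedContinuousFunction.toReal_lintegral_coe_eq_integral g μ,
        BoundedContinuousFunction.toReal_lintegral_coe_eq_integral g ν]
      exact hint
    exact ((ENNReal.toReal_eq_toReal_iff' (BoundedContinuousFunction.lintegral_lt_top_of_nnreal ν g).ne
      (BoundedContinuousFunction.lintegral_lt_top_of_nnreal μ g).ne).1 h1.symm)
  apply ext_of_generate_finite _ ?_ isPiSystem_isClosed
  · exact fun F hF => key F hF
  · exact key _ isClosed_univ
  · rw [BorelSpace.measurable_eq (α := X), borel_eq_generateFrom_isClosed]

/-- **Full identification from the product-cell structure** (the soft assembly of the gate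
transfer): `GateDecomposition`, `RenewalAccumulation`, `CarvedToSLE` and the eventual product
structure of the cells (`productCell`, with prefix/suffix diameter bound `16 R`) identify every
probability subsequential limit law of the critical hexagonal SAW as the chordal SLE(8/3) law. -/
theorem fullIdentification_of_productCell
    (hGD : ∀ (Ω : Set ℂ) (δ : ℝ) (a b p q p' q' : HexVertex) (S T : Set HexVertex)
       (l₁ l₂ : List HexVertex) (B : Set (List HexVertex)),
       Disjoint S T →
       (∃ w₁ : (hexDomainGraph Ω δ).Walk a p, w₁.IsPath ∧ w₁.support = l₁ ∧ ∀ v ∈ l₁, v ∈ S) →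
       (∃ w₂ : (hexDomainGraph Ω δ).Walk p' b, w₂.IsPath ∧ w₂.support = l₂ ∧ ∀ v ∈ l₂, v ∈ T) →
       (hexDomainGraph Ω δ).Adj p q → (hexDomainGraph Ω δ).Adj q' p' →
       hexSAWWeight Ω δ a b
           {γ | ∃ mid ∈ B, mid.head? = some q ∧ mid.getLast? = some q' ∧
             (∀ v ∈ mid, v ∉ S ∧ v ∉ T) ∧ γ.walk.support = l₁ ++ mid ++ l₂} =
         ENNReal.ofReal (hexCriticalFugacity ^ (l₁.length + l₂.length)) *
           hexSAWWeight Ω δ q q'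
             {γ | γ.walk.support ∈ B ∧ ∀ v ∈ γ.walk.support, v ∉ S ∧ v ∉ T})
    (hRA : ∀ (D : DobrushinDomain) (a b : ℝ → HexVertex), IsEmbEndpointApprox hexGraph hexCenter D a b →
       ∀ ε > (0 : ℝ), ∀ R > (0 : ℝ), ∃ r ∈ Set.Ioo (0 : ℝ) R, ∃ ρ > (0 : ℝ), ∀ᶠ δ : ℝ in 𝓝[>] 0,
         hexSAWLaw D.carrier δ (a δ) (b δ)
             {γ | ¬ (GoodRenewalAt D.carrier δ r R ρ (a δ) γ.walk.support ∧
                     GoodRenewalAt D.carrier δ r R ρ (b δ) γ.walk.support.reverse)} ≤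
           ENNReal.ofReal ε)
    (hCTS : ∀ (D : DobrushinDomain) (a b : ℝ → HexVertex), IsEmbEndpointApprox hexGraph hexCenter D a b →
       ∀ (ν : Measure (CurveClass ℂ)), IsSLELaw ((8 : ℝ≥0) / 3) D ν →
       ∀ (f : CurveClass ℂ →ᵇ ℝ) (ε : ℝ), 0 < ε →
         ∃ R₀ > (0 : ℝ), ∀ R ∈ Set.Ioc (0 : ℝ) R₀, ∀ r ∈ Set.Ioc (0 : ℝ) R, ∀ ρ > (0 : ℝ),
           ∀ᶠ δ : ℝ in 𝓝[>] 0,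
             hexSAWLaw D.carrier δ (a δ) (b δ)
               {γ | ∃ (n m : ℕ) (p q : HexVertex) (n' m' : ℕ) (p' q' : HexVertex),
                   IsFirstGoodGate D.carrier δ r R ρ (a δ) γ.walk.support n m p q ∧
                   IsFirstGoodGate D.carrier δ r R ρ (b δ) γ.walk.support.reverse n' m' p' q' ∧
                   ε < |(∫ ξ, f ξ.curve ∂(carvedLaw D.carrier δ
                           (sideVerts D.carrier δ (a δ) n p q ∪ sideVerts D.carrier δ (b δ) n' p' q')
                           q q')) - ∫ x, f x ∂ν|} ≤ ENNReal.ofReal ε)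
    (hcells : ∀ (D : DobrushinDomain) (a b : ℝ → HexVertex), IsEmbEndpointApprox hexGraph hexCenter D a b →
       ∃ R₁ > (0 : ℝ), ∀ R ∈ Set.Ioc (0 : ℝ) R₁, ∀ r ∈ Set.Ioo (0 : ℝ) R, ∀ ρ > (0 : ℝ),
         ∀ᶠ δ : ℝ in 𝓝[>] 0, ∀ γ₀ : HexDomainSAW D.carrier δ (a δ) (b δ),
           γ₀ ∈ productCell D.carrier δ r R ρ (a δ) (b δ) (16 * R))
    (D : DobrushinDomain) (a b : ℝ → HexVertex) (hab : IsEmbEndpointApprox hexGraph hexCenter D a b)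
    (μ : Measure (CurveClass ℂ)) (hμ : IsProbabilityMeasure μ)
    (hsub : IsSubseqLimitLaw (fun δ (γ : HexDomainSAW D.carrier δ (a δ) (b δ)) => γ.curve)
      (fun δ => hexSAWLaw D.carrier δ (a δ) (b δ)) μ) :
    IsSLELaw ((8 : ℝ≥0) / 3) D μ := by
  obtain ⟨ν, hν⟩ := exists_isSLELaw_of_ne_eight (κ := (8 : ℝ≥0) / 3) (by positivity) (by norm_num) D
  obtain ⟨Γ, hΓ, rfl⟩ := hν
  haveI := isProbabilityMeasure_preWienerMeasure'
  haveI : IsProbabilityMeasure (Literature.Probability.Process.preWienerMeasure.map Γ) :=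
    Measure.isProbabilityMeasure_map hΓ.1
  suffices hμν : μ = Literature.Probability.Process.preWienerMeasure.map Γ from ⟨Γ, hΓ, hμν⟩
  set ν := Literature.Probability.Process.preWienerMeasure.map Γ with hνdef
  have hνlaw : IsSLELaw ((8 : ℝ≥0) / 3) D ν := ⟨Γ, hΓ, rfl⟩
  obtain ⟨s, hs, hlim⟩ := hsub
  refine ext_of_forall_lipschitz_integral_eq fun f K hf => ?_
  -- `|∫ f dμ - ∫ f dν| ≤ η` for every `η > 0`
  have key : ∀ η : ℝ, 0 < η → |∫ x, f x ∂μ - ∫ x, f x ∂ν| ≤ η := by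
    intro η hη
    set ε : ℝ := η / (2 * (1 + 4 * ‖f‖)) with hε
    have hε0 : 0 < ε := by positivity
    obtain ⟨R₀, hR₀, hCTS'⟩ := hCTS D a b hab ν hνlaw f ε hε0
    obtain ⟨R₁, hR₁, hcells'⟩ := hcells D a b hab
    set R : ℝ := min (min R₀ R₁) (η / (2 * (16 * K + 1))) with hR
    have hRpos : 0 < R := by positivity
    have hRR₀ : R ≤ R₀ := (min_le_left _ _).trans (min_le_left _ _)
    have hRR₁ : R ≤ R₁ := (min_le_left _ _).trans (min_le_right _ _)
    have hK : (0 : ℝ) ≤ K := K.2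
    have hRη : (K : ℝ) * (16 * R) ≤ η / 2 := by
      have h1 : R ≤ η / (2 * (16 * K + 1)) := min_le_right _ _
      calc (K : ℝ) * (16 * R) = 16 * K * R := by ring
        _ ≤ (16 * K + 1) * R := by nlinarith
        _ ≤ (16 * K + 1) * (η / (2 * (16 * K + 1))) := mul_le_mul_of_nonneg_left h1 (by positivity)
        _ = η / 2 := by field_simp
    have hεη : ε * (1 + 4 * ‖f‖) = η / 2 := by
      rw [hε]; field_simp
    obtain ⟨r, hr, ρ, hρ, hRA'⟩ := hRA D a b hab ε hε0 R hRpos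
    have hCTS'' := hCTS' R ⟨hRpos, hRR₀⟩ r ⟨hr.1, hr.2.le⟩ ρ hρ
    have hcells'' := hcells' R ⟨hRpos, hRR₁⟩ r hr ρ hρ
    have hprob := eventually_isProbabilityMeasure_hexSAWLaw hab
    have hev : ∀ᶠ δ : ℝ in 𝓝[>] 0,
        |∫ γ, f γ.curve ∂(hexSAWLaw D.carrier δ (a δ) (b δ)) - ∫ x, f x ∂ν| ≤ η := by
      filter_upwards [hRA', hCTS'', hcells'', hprob, self_mem_nhdsWithin] with δ h1 h2 h3 h4 hδ
      haveI := h4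
      have hest := abs_integral_sub_le_of_productCell (r := r) (R := R) (ρ := ρ) D.isBounded hδ
        (by positivity : (0 : ℝ) ≤ 16 * R) (hGD D.carrier δ (a δ) (b δ)) h3 ν f hf hε0.le
        (ENNReal.toReal_le_of_le_ofReal hε0.le h1) (ENNReal.toReal_le_of_le_ofReal hε0.le h2)
      calc _ ≤ K * (16 * R) + ε * (1 + 4 * ‖f‖) := hest
        _ ≤ η / 2 + η / 2 := add_le_add hRη hεη.le
        _ = η := by ring
    have hev' : ∀ᶠ n in atTop, |∫ γ, f γ.curve ∂(hexSAWLaw D.carrier (s n) (a (s n)) (b (s n))) -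
        ∫ x, f x ∂ν| ≤ η := hs.eventually hev
    have hcont : Tendsto (fun n => |∫ γ, f γ.curve ∂(hexSAWLaw D.carrier (s n) (a (s n)) (b (s n))) -
        ∫ x, f x ∂ν|) atTop (𝓝 |∫ x, f x ∂μ - ∫ x, f x ∂ν|) :=
      ((hlim f).sub tendsto_const_nhds).abs
    exact le_of_tendsto hcont hev'
  have h0 : |∫ x, f x ∂μ - ∫ x, f x ∂ν| ≤ 0 :=
    le_of_forall_pos_le_add fun η hη => by rw [zero_add]; exact key η hη
  exact sub_eq_zero.1 (abs_eq_zero.1 (le_antisymm h0 (abs_nonneg _)))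

end Final

end Summit.CriticalPhenomena.SAWScalingLimit.Theorems.ObservableToSLER.BridgeGate

namespace Summit.CriticalPhenomena.SAWScalingLimit.Theorems.ObservableToSLER.BridgeGate

open Literature.Probability.LatticeModels (HexVertex hexGraph hexCenter triZeta Site)
open Literature.Probability.RandomPlanarGeometry
open Literature.Probability.RandomPlanarGeometry.SAW
open Summit.CriticalPhenomena.SAWScalingLimit.Theses.SAWDefectDecoherence
  (HexObservableLimitR HexTight ObservableToSLER)

/-- **STUB 6 of the line `bridge-gate-renewal` — THE GATE TRANSFER**
`GateDecomposition → RenewalAccumulation → CarvedToSLE → HexTight → FullIdentification`: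
every probability subsequential limit law of the critical hexagonal SAW in a Dobrushin domain is
the chordal SLE(8/3) law.  Proof: the eventual product structure of the cells of the good event
(`eventually_productCell`: crosscut topology of the gates in the Jordan domain) feeds the soft
assembly `fullIdentification_of_productCell` (exact factorisation per cell, Lipschitz comparison
of the curve with its middle piece, summation against `CarvedToSLE` and `RenewalAccumulation`,
limit along the subsequence, separation of measures by bounded Lipschitz functions).  The
tightness hypothesis is not needed for this implication. -/
theorem stub_gateTransfer :
    (∀ (Ω : Set ℂ) (δ : ℝ) (a b p q p' q' : HexVertex) (S T : Set HexVertex) (l₁ l₂ : List HexVertex)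
       (B : Set (List HexVertex)),
       Disjoint S T →
       (∃ w₁ : (hexDomainGraph Ω δ).Walk a p, w₁.IsPath ∧ w₁.support = l₁ ∧ ∀ v ∈ l₁, v ∈ S) →
       (∃ w₂ : (hexDomainGraph Ω δ).Walk p' b, w₂.IsPath ∧ w₂.support = l₂ ∧ ∀ v ∈ l₂, v ∈ T) →
       (hexDomainGraph Ω δ).Adj p q → (hexDomainGraph Ω δ).Adj q' p' →
       hexSAWWeight Ω δ a b
           {γ | ∃ mid ∈ B, mid.head? = some q ∧ mid.getLast? = some q' ∧
             (∀ v ∈ mid, v ∉ S ∧ v ∉ T) ∧ γ.walk.support = l₁ ++ mid ++ l₂} =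
         ENNReal.ofReal (hexCriticalFugacity ^ (l₁.length + l₂.length)) *
           hexSAWWeight Ω δ q q'
             {γ | γ.walk.support ∈ B ∧ ∀ v ∈ γ.walk.support, v ∉ S ∧ v ∉ T}) →
    (∀ (D : DobrushinDomain) (a b : ℝ → HexVertex), IsEmbEndpointApprox hexGraph hexCenter D a b →
       ∀ ε > (0 : ℝ), ∀ R > (0 : ℝ), ∃ r ∈ Set.Ioo (0 : ℝ) R, ∃ ρ > (0 : ℝ), ∀ᶠ δ : ℝ in 𝓝[>] 0,
         hexSAWLaw D.carrier δ (a δ) (b δ)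
             {γ | ¬ (GoodRenewalAt D.carrier δ r R ρ (a δ) γ.walk.support ∧
                     GoodRenewalAt D.carrier δ r R ρ (b δ) γ.walk.support.reverse)} ≤
           ENNReal.ofReal ε) →
    (∀ (D : DobrushinDomain) (a b : ℝ → HexVertex), IsEmbEndpointApprox hexGraph hexCenter D a b →
       ∀ (ν : Measure (CurveClass ℂ)), IsSLELaw ((8 : ℝ≥0) / 3) D ν →
       ∀ (f : CurveClass ℂ →ᵇ ℝ) (ε : ℝ), 0 < ε →
         ∃ R₀ > (0 : ℝ), ∀ R ∈ Set.Ioc (0 : ℝ) R₀, ∀ r ∈ Set.Ioc (0 : ℝ) R, ∀ ρ > (0 : ℝ),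
           ∀ᶠ δ : ℝ in 𝓝[>] 0,
             hexSAWLaw D.carrier δ (a δ) (b δ)
               {γ | ∃ (n m : ℕ) (p q : HexVertex) (n' m' : ℕ) (p' q' : HexVertex),
                   IsFirstGoodGate D.carrier δ r R ρ (a δ) γ.walk.support n m p q ∧
                   IsFirstGoodGate D.carrier δ r R ρ (b δ) γ.walk.support.reverse n' m' p' q' ∧
                   ε < |(∫ ξ, f ξ.curve ∂(carvedLaw D.carrier δ
                           (sideVerts D.carrier δ (a δ) n p q ∪ sideVerts D.carrier δ (b δ) n' p' q')
                           q q')) - ∫ x, f x ∂ν|} ≤ ENNReal.ofReal ε) →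
    HexTight →
    ∀ (D : DobrushinDomain) (a b : ℝ → HexVertex),
      IsEmbEndpointApprox hexGraph hexCenter D a b →
      ∀ μ : Measure (CurveClass ℂ), IsProbabilityMeasure μ →
        IsSubseqLimitLaw (fun δ (γ : HexDomainSAW D.carrier δ (a δ) (b δ)) => γ.curve)
          (fun δ => hexSAWLaw D.carrier δ (a δ) (b δ)) μ →
        IsSLELaw ((8 : ℝ≥0) / 3) D μ :=
  fun hGD hRA hCTS _ D a b hab μ hμ hsub =>
    fullIdentification_of_productCell hGD hRA hCTS (fun D a b hab => eventually_productCell D a b hab)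
      D a b hab μ hμ hsub

end Summit.CriticalPhenomena.SAWScalingLimit.Theorems.ObservableToSLER.BridgeGate


end
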